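/-
Origin: expansion seat `prover-pub-hodgecm-mc-binder-1-g12-0`, handover #63 2026-08-20T12:34:15Z md5 58c400484ed7 (NEW additive KERNEL leaf; imports #62 + #59; drop rule #62 ⇒ {#63}) (`HOME/mc/pub-hodgecm-mc-binder-1-g12/stage51/HodgeCM/Model/Binders/Real34IsoMonoScale.lean`, md5 58c400484ed7, 119 lines);
landed by the gen-20 packager (p-g20) in gate run 51 as `HodgeCM/Model/Binders/Real34IsoMonoScale.lean` (verbatim).
-/
/-
Origin: pub-hodgecm MODEL-CONSTRUCTION sub-cell (Hodge conjecture, CM-per-L package), seat mc-binder-1 gen 12, session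
prover-pub-hodgecm-mc-binder-1-g12-0, 2026-08-20.  Target in PKG: HodgeCM/Model/Binders/Real34IsoMonoScale.lean (NEW additive leaf; imports RUN-51 #62
`Binders/Real34IsoScaleFrame` + RUN-50 #59 `Binders/Real34ScaledFrameSubst`).  KERNEL MATHEMATICS ONLY.  Consumer: `harch` of the row-17 socket, HARCH-PLAN.md §5/§7 (2):
the scaling-vector equality `monoScale π s (pairScale N 2 cmDV (cmDW dW)) = pairScale N 2 cmDV (cmDW dW′)` for the monomial data of binder-2's `isoMat`.
-/
import Summits.HodgeConjecture.HodgeCM.Model.Binders.Real34IsoScaleFrame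
import Summits.HodgeConjecture.HodgeCM.Model.Binders.Real34ScaledFrameSubst

/-!
# Row 17 (`real34`): the monomial data of `isoMat` and the scaling-vector equality of the two scaled frames

Data (HARCH-PLAN §5): through the pin's index bijection `e : Fin N × Fin 2 ≃ Fin n`, at a real place `v` of `L⁺` with chosen complex place `w = cmPlaceOver L v`
and binder-2's place permutation `σ_v := placePerm L dW dW' w` and scales `isoScale_w`:

* `isoMonoPerm … v : Equiv.Perm (Fin n)` — `e (i, j) ↦ e (i, σ_v⁻¹ j)` (the `W`-index permutation of `x ↦ (1 ⊗ isoMat_w) x`, `(isoMat x)_j = isoScale (σ⁻¹ j) · x_{σ⁻¹ j}`);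
* `isoMonoScale … (k, v) = isoScale_w (σ_v⁻¹ (e⁻¹ k).2)`;
* **`monoScale_isoMono_pairScale`**: `monoScale (isoMonoPerm …) (isoMonoScale …) (pairScale N 2 (cmDV …) (cmDW … dW …)) = pairScale N 2 (cmDV …) (cmDW … dW' …)`
  (given `placeRatio_pos` at every `cmPlaceOver L v`) — so, by #59 `comp_monoSubst_follandFock_scaledFrame`, the substituted census letter
  `(follandFock cmBigFrame P) ∘ monoSubst (isoMonoPerm …) (isoMonoScale …)` is `follandFock cmBigFrame′ (rename (monoIdx (isoMonoPerm …))⁻¹ P)` with `cmBigFrame′` the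
  scaled frame of the see-saw pin `diag(dW')` (same `e`, same `cmDV`): **`comp_isoMonoSubst_follandFock_cmBigFrame`**.

Orientation: this is the substitution `Φ ↦ Φ ∘ (1 ⊗ isoMat)` = `ω(leviPair m)` for `m`'s `X`-block `1 ⊗ isoMat⁻¹` (`leviOp (glEquiv a) f = f ∘ a⁻¹`); if K-1's (i″) comes
out with the inverse orientation, swap `σ_v ↔ σ_v⁻¹` and `isoScale ↔ isoScale⁻¹` here (then the target frame is NOT `cmBigFrame′` — a sign that the orientation is wrong).

## References
* [Folland1989] G. B. Folland, *Harmonic Analysis in Phase Space*, Princeton UP (1989), §4.2.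
-/

set_option autoImplicit false

noncomputable section

open NumberField NumberField.InfinitePlace NumberField.mixedEmbedding MvPolynomial
open Literature.Analysis.SegalBargmann Literature.NumberTheory.Weil1964 Literature.NumberTheory.Automorphic

namespace HodgeCM.Model.HypCensus

open scoped Classical

variable (L : Type) [Field L] [NumberField L] [IsCMField L] {N n : ℕ} (e : Fin N × Fin 2 ≃ Fin n)
variable (dV : Fin N → L) (hdV : ∀ i, IsCMField.complexConj L (dV i) = dV i) (hdV0 : ∀ i, dV i ≠ 0) (ι₁ : L →+* ℂ)
variable (dW dW' : Fin 2 → L) (hdW : ∀ i, IsCMField.complexConj L (dW i) = dW i) (hdW0 : ∀ i, dW i ≠ 0)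
  (hdW' : ∀ i, IsCMField.complexConj L (dW' i) = dW' i) (hdW0' : ∀ i, dW' i ≠ 0)

/-! ## §1 The monomial data of `isoMat` through the pin's index bijection -/

/-- The place-wise `W`-index permutation of `x ↦ (1 ⊗ isoMat_w) x`: `e (i, j) ↦ e (i, σ_v⁻¹ j)`, `σ_v = placePerm L dW dW' (cmPlaceOver L v)`. [folklore] -/
def isoMonoPerm (v : {v : InfinitePlace ↥(maximalRealSubfield L) // v.IsReal}) : Equiv.Perm (Fin n) :=
  (e.symm.trans ((Equiv.refl (Fin N)).prodCongr (placePerm L dW dW' (cmPlaceOver L v).1).symm)).trans e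

/-- see `isoMonoPerm`. [folklore] -/
@[simp] theorem isoMonoPerm_apply (v : {v : InfinitePlace ↥(maximalRealSubfield L) // v.IsReal}) (k : Fin n) :
    isoMonoPerm L e dW dW' v k = e ((e.symm k).1, (placePerm L dW dW' (cmPlaceOver L v).1).symm (e.symm k).2) := rfl

/-- see `isoMonoPerm`. [folklore] -/
@[simp] theorem isoMonoPerm_symm_apply (v : {v : InfinitePlace ↥(maximalRealSubfield L) // v.IsReal}) (k : Fin n) :
    (isoMonoPerm L e dW dW' v).symm k = e ((e.symm k).1, placePerm L dW dW' (cmPlaceOver L v).1 (e.symm k).2) := by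
  rw [Equiv.symm_apply_eq, isoMonoPerm_apply, Equiv.symm_apply_apply, Equiv.symm_apply_apply, Equiv.apply_symm_apply]

/-- The place-wise scales of `x ↦ (1 ⊗ isoMat_w) x` through `e`: `isoMonoScale (k, v) = isoScale_w (σ_v⁻¹ (e⁻¹ k).2)`. [folklore] -/
def isoMonoScale (k : Fin n × {v : InfinitePlace ↥(maximalRealSubfield L) // v.IsReal}) : ℝ :=
  isoScale (placeRe L dW (cmPlaceOver L k.2).1) (placeRe L dW' (cmPlaceOver L k.2).1)
    ((placePerm L dW dW' (cmPlaceOver L k.2).1).symm (e.symm k.1).2)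

/-- see `isoMonoScale`. [folklore] -/
@[simp] theorem isoMonoScale_apply (k : Fin n × {v : InfinitePlace ↥(maximalRealSubfield L) // v.IsReal}) :
    isoMonoScale L e dW dW' k = isoScale (placeRe L dW (cmPlaceOver L k.2).1) (placeRe L dW' (cmPlaceOver L k.2).1)
      ((placePerm L dW dW' (cmPlaceOver L k.2).1).symm (e.symm k.1).2) := rfl

/-- The scales are non-zero when the place ratios are positive (binder-2's `placeRatio_pos`). [folklore] -/
theorem isoMonoScale_ne_zero
    (hr : ∀ (v : {v : InfinitePlace ↥(maximalRealSubfield L) // v.IsReal}) (i : Fin 2),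
      0 < placeRe L dW' (cmPlaceOver L v).1 i / placeRe L dW (cmPlaceOver L v).1 (placePerm L dW dW' (cmPlaceOver L v).1 i))
    (k : Fin n × {v : InfinitePlace ↥(maximalRealSubfield L) // v.IsReal}) : isoMonoScale L e dW dW' k ≠ 0 :=
  isoScale_ne_zero (hr k.2) _

/-! ## §2 The scaling-vector equality -/

/-- Scaled frames with equal scalings are equal (the non-vanishing proof is irrelevant), on Folland letters. [folklore] -/
theorem follandFock_scaledFrame_congr {F : Type} [Field F] [NumberField F] [IsTotallyReal F] {ι : Type} [Fintype ι] [DecidableEq ι]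
    {D D' : ι × {v : InfinitePlace F // v.IsReal} → ℝ} (h : D = D') (hD : ∀ k, D k ≠ 0) (hD' : ∀ k, D' k ≠ 0)
    (P : MvPolynomial (ι × {v : InfinitePlace F // v.IsReal}) ℂ) :
    follandFock (scaledFrame F ι D hD) P = follandFock (scaledFrame F ι D' hD') P := by
  subst h
  rfl

/-- **`monoScale (isoMonoPerm) (isoMonoScale) (pairScale N 2 cmDV (cmDW dW)) = pairScale N 2 cmDV (cmDW dW')`** — the census pin's scaled-frame weights after
the monomial substitution are the see-saw pin's. [folklore] -/
theorem monoScale_isoMono_pairScale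
    (hr : ∀ (v : {v : InfinitePlace ↥(maximalRealSubfield L) // v.IsReal}) (i : Fin 2),
      0 < placeRe L dW' (cmPlaceOver L v).1 i / placeRe L dW (cmPlaceOver L v).1 (placePerm L dW dW' (cmPlaceOver L v).1 i)) :
    monoScale (isoMonoPerm L e dW dW') (isoMonoScale L e dW dW') (pairScale N 2 (e := e) (cmDV L dV hdV ι₁) (cmDW L dV dW hdW ι₁)) =
      pairScale N 2 (e := e) (cmDV L dV hdV ι₁) (cmDW L dV dW' hdW' ι₁) := by
  funext k
  obtain ⟨k, v⟩ := k
  rw [monoScale_apply, isoMonoPerm_symm_apply, isoMonoScale_apply]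
  simp only [pairScale, Equiv.symm_apply_apply, Equiv.symm_apply_apply]
  rw [mul_assoc, cmDW_placePerm_mul_isoScale L dV ι₁ dW dW' hdW hdW' v (hr v)]

/-- **The substituted census letter lives in the see-saw pin's scaled frame**:
`(follandFock (scaledFrame (pairScale N 2 cmDV (cmDW dW))) P) ∘ monoSubst (isoMonoPerm) (isoMonoScale) = follandFock (scaledFrame (pairScale N 2 cmDV (cmDW dW'))) (rename (monoIdx isoMonoPerm)⁻¹ P)`.
[cite: Folland1989, §4.2] -/
theorem comp_isoMonoSubst_follandFock_cmBigFrame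
    (hr : ∀ (v : {v : InfinitePlace ↥(maximalRealSubfield L) // v.IsReal}) (i : Fin 2),
      0 < placeRe L dW' (cmPlaceOver L v).1 i / placeRe L dW (cmPlaceOver L v).1 (placePerm L dW dW' (cmPlaceOver L v).1 i))
    (P : MvPolynomial (Fin n × {v : InfinitePlace ↥(maximalRealSubfield L) // v.IsReal}) ℂ) :
    SchwartzMap.compCLMOfContinuousLinearEquiv ℂ (monoSubst (isoMonoPerm L e dW dW') (isoMonoScale L e dW dW') (isoMonoScale_ne_zero L e dW dW' hr))
        (follandFock (scaledFrame ↥(maximalRealSubfield L) (Fin n) (pairScale N 2 (e := e) (cmDV L dV hdV ι₁) (cmDW L dV dW hdW ι₁))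
          (pairScale_ne_zero N 2 (cmDV_ne_zero L dV hdV hdV0 ι₁) (cmDW_ne_zero L dV dW hdW hdW0 ι₁))) P) =
      follandFock (scaledFrame ↥(maximalRealSubfield L) (Fin n) (pairScale N 2 (e := e) (cmDV L dV hdV ι₁) (cmDW L dV dW' hdW' ι₁))
          (pairScale_ne_zero N 2 (cmDV_ne_zero L dV hdV hdV0 ι₁) (cmDW_ne_zero L dV dW' hdW' hdW0' ι₁)))
        (rename (monoIdx (isoMonoPerm L e dW dW')).symm P) := by
  rw [comp_monoSubst_follandFock_scaledFrame]
  exact follandFock_scaledFrame_congr (monoScale_isoMono_pairScale L e dV hdV ι₁ dW dW' hdW hdW' hr) _ _ _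

end HodgeCM.Model.HypCensus

end
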